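import Summits.HodgeConjecture.HodgeConjecture.Theses.NoetherLefschetzOneUp
import Summits.HodgeConjecture.HodgeConjecture.Theorems.NoetherLefschetzOneUpMiddleReduction
import Summits.HodgeConjecture.HodgeConjecture.Theorems.NoetherLefschetzOneUpNetReduction

/-!
# Line `netRegimeSplit` for the crux `SummitGrantedFourfolds` (stmt-HodgeConjecture-14600) —
# net classes modulo vertical × regime, vertical classes peeled off as a print theorem

Crux-strategist line (route `NoetherLefschetzOneUp`, crux rank 4, `SummitGrantedFourfolds :=
HC(4;2,2) → [∀ n X: Nonempty (HodgeModel n X) ∧ every rational (p,p)-class algebraic]`).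

The registered line `birth` cuts the open content of the crux — the middle degree `(m,m)` of smooth
projective `2m`-folds, `m ≥ 3` — along the DIMENSION ladder only (`m = 3` | `m ≥ 4`). This line cuts
it along the route's own MECHANISM as well: every `2m`-fold enters through a net of `(2m-2)`-folds
over `ℙ²` (a THEOREM of the tree: `Motives.exists_fiberNet_smoothBase_nonempty_holds`, with the
birational descent `mem_algebraicClasses_of_isBirational`), and on the total space a rational
`(m,m)`-class splits into

* its class MODULO VERTICAL classes — `stub_sixfoldNetClasses` (level 3, fed with `HC(4;2,2)`: the
  exact analogue one level up, for all fibre types, of the rank-2 crux `K3TypeNets`) and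
  `stub_higherNetClasses` (levels `≥ 4`, granted all lower levels: the declared open boundary) — the
  OPEN content ("middle Hodge classes have coniveau ≥ 1"), and
* the VERTICAL classes (vanishing off `f⁻¹(T)`, `T ⊊ ℙ²` Zariski-closed) — `stub_higherVerticalClasses`,
  uniform in `m ≥ 3` granted all lower levels: a THEOREM IN PRINT (Deligne, Hodge III Cor. 8.2.8 +
  the semisimple lift of Hodge classes along Gysin maps + Hironaka reduce it to the Hodge conjecture
  one below the middle on `(2m-1)`-folds, which the lower levels give by de Cataldo–Migliorini /
  Thomas below the middle — the tree's `mem_algebraicClasses_of_two_mul_le` — and hard Lefschetz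
  above it), the analogue of the support item `VerticalHodgeAlgebraic`.

`SummitGrantedFourfolds_of` (no `sorry`; axioms `propext` · `Classical.choice` · `Quot.sound`) is the
assembly: strong induction on `m` over the proved floor (`algebraicClasses_zero`,
`LefschetzOneOne_holds`, the hypothesis `HC(4;2,2)`), nets + the three stubs at `m ≥ 3`, then
`Theorems.middleReduction_proof` (BFNP Lemma 48) and `HodgeModels_holds`. It is also the glue theorem
of the route split `SummitGrantedFourfolds ⇐ SixfoldNetClasses ∧ HigherNetClasses ∧
HigherVerticalClasses` (the three stub statements, verbatim, are the children's statements).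

Bridge to the registered line `birth`: `birth_stub_sixfoldsGrantedFourfolds_of_pieces` and
`birth_stub_ladderFromEightfolds_of_pieces` derive the lead's two stubs (restated verbatim) from this
line's stubs (no `sorry`). `sorry` occurs only inside the three `stub_*` theorems.
-/

set_option linter.dupNamespace false

noncomputable section

namespace Summit.HodgeConjecture.HodgeConjecture.Cruxes.SummitGrantedFourfolds.NetRegimeSplit

open CategoryTheory AlgebraicGeometry
open Literature.AlgebraicGeometry Literature.AlgebraicGeometry.Motives
open Literature.AlgebraicGeometry.HodgeTheory
open Summit.HodgeConjecture.HodgeConjecture.Theses.NoetherLefschetzOneUp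

/-- **Stub 1 — sixfold net classes modulo vertical, granted `HC(4;2,2)`** (OPEN; the level-3 crux
piece `SixfoldNetClasses`): for every smooth projective complex sixfold `X` with a surjective
`f : X ⟶ ℙ²`, the span of the rational `(3,3)`-classes lies in `algebraicClasses X 3 ⊔ V_f`, `V_f`
the span of the rational `(3,3)`-classes vanishing on `X ∖ f⁻¹(T)` for some proper closed `T ⊊ ℙ²`.
[Deligne2000; Arapura2022 §1; vanGeemen1994HodgeAV Thm 4.11] -/
theorem stub_sixfoldNetClasses :
    (∀ ⦃X : Literature.AlgebraicGeometry.Motives.SchemeOver ℂ⦄, Literature.AlgebraicGeometry.Motives.IsSmoothProjective 4 X → ∀ c : Literature.AlgebraicGeometry.HodgeTheory.complexBetti X (2 * 2), Literature.AlgebraicGeometry.HodgeTheory.IsRationalClass c → Literature.AlgebraicGeometry.HodgeTheory.IsOfHodgeType 4 X (2 * 2) 2 2 c → c ∈ Literature.AlgebraicGeometry.HodgeTheory.algebraicClasses X 2) → ∀ ⦃X : Literature.AlgebraicGeometry.Motives.SchemeOver ℂ⦄ (f : X ⟶ Literature.AlgebraicGeometry.Motives.projectiveSpace 2 ℂ),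 Literature.AlgebraicGeometry.Motives.IsSmoothProjective 6 X → Function.Surjective f.left.base → Submodule.span ℂ {c : Literature.AlgebraicGeometry.HodgeTheory.complexBetti X (2 * 3) | Literature.AlgebraicGeometry.HodgeTheory.IsRationalClass c ∧ Literature.AlgebraicGeometry.HodgeTheory.IsOfHodgeType 6 X (2 * 3) 3 3 c} ≤ Literature.AlgebraicGeometry.HodgeTheory.algebraicClasses X 3 ⊔ Submodule.span ℂ {c : Literature.AlgebraicGeometry.HodgeTheory.complexBetti X (2 * 3) | Literature.AlgebraicGeometry.HodgeTheory.IsRationalClass c ∧ Literature.AlgebraicGeometry.HodgeTheory.IsOfHodgeType 6 X (2 * 3) 3 3 c ∧ ∃ T : Set (Literature.AlgebraicGeometry.Motives.projectiveSpace 2 ℂ).left, IsClosed T ∧ T ≠ Set.univ ∧ Literature.AlgebraicGeometry.HodgeTheory.complexBetti.restrictCompl X (f.left.base ⁻¹' T) (2 * 3) c = 0} := by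
  sorry

/-- **Stub 2 — net classes modulo vertical at every level `m ≥ 4`, granted all lower levels**
(OPEN; the crux piece `HigherNetClasses`, the declared open boundary of the route in ladder form).
[Deligne2000; BrosnanFangNiePearlstein2009 Lemma 48; Arapura2022 §1] -/
theorem stub_higherNetClasses :
    ∀ ⦃m : ℕ⦄, 4 ≤ m → (∀ m' : ℕ, m' < m → ∀ ⦃X : Literature.AlgebraicGeometry.Motives.SchemeOver ℂ⦄, Literature.AlgebraicGeometry.Motives.IsSmoothProjective (2 * m') X → ∀ c : Literature.AlgebraicGeometry.HodgeTheory.complexBetti X (2 * m'), Literature.AlgebraicGeometry.HodgeTheory.IsRationalClass c → Literature.AlgebraicGeometry.HodgeTheory.IsOfHodgeType (2 * m') X (2 * m') m' m' c → c ∈ Literature.AlgebraicGeometry.HodgeTheory.algebraicClasses X m') → ∀ ⦃X : Literature.AlgebraicGeometry.Motives.SchemeOver ℂ⦄ (f : X ⟶ Literature.AlgebraicGeometry.Motives.projectiveSpace 2 ℂ), Literature.AlgebraicGeometry.Motives.IsSmoothProjective (2 * m) X → Function.Surjective f.left.base → Submodule.span ℂ {c : Literature.AlgebraicGeometry.HodgeTheory.complexBetti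 X (2 * m) | Literature.AlgebraicGeometry.HodgeTheory.IsRationalClass c ∧ Literature.AlgebraicGeometry.HodgeTheory.IsOfHodgeType (2 * m) X (2 * m) m m c} ≤ Literature.AlgebraicGeometry.HodgeTheory.algebraicClasses X m ⊔ Submodule.span ℂ {c : Literature.AlgebraicGeometry.HodgeTheory.complexBetti X (2 * m) | Literature.AlgebraicGeometry.HodgeTheory.IsRationalClass c ∧ Literature.AlgebraicGeometry.HodgeTheory.IsOfHodgeType (2 * m) X (2 * m) m m c ∧ ∃ T : Set (Literature.AlgebraicGeometry.Motives.projectiveSpace 2 ℂ).left, IsClosed T ∧ T ≠ Set.univ ∧ Literature.AlgebraicGeometry.HodgeTheory.complexBetti.restrictCompl X (f.left.base ⁻¹' T) (2 * m) c = 0} := by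
  sorry

/-- **Stub 3 — vertical classes are algebraic at every level `m ≥ 3`, granted all lower levels**
(a THEOREM IN PRINT, open in the tree; the support piece `HigherVerticalClasses`): Deligne, Hodge III
Cor. 8.2.8 + semisimple lift along Gysin morphisms + Hironaka + the Hodge conjecture below the middle
from pencils (de Cataldo–Migliorini 2009 §4 / Thomas 2005 §2) + hard Lefschetz.
[DeligneHodgeIII1974 Cor. 8.2.8; Voisin2025 Cor. 2.12; DecataldoMigliorini2009 §4; Thomas2005Nodes §2] -/
theorem stub_higherVerticalClasses :
    ∀ ⦃m : ℕ⦄, 3 ≤ m → (∀ m' : ℕ, m' < m → ∀ ⦃X : Literature.AlgebraicGeometry.Motives.SchemeOver ℂ⦄, Literature.AlgebraicGeometry.Motives.IsSmoothProjective (2 * m') X → ∀ c : Literature.AlgebraicGeometry.HodgeTheory.complexBetti X (2 * m'), Literature.AlgebraicGeometry.HodgeTheory.IsRationalClass c → Literature.AlgebraicGeometry.HodgeTheory.IsOfHodgeType (2 * m') X (2 * m') m' m' c → c ∈ Literature.AlgebraicGeometry.HodgeTheory.algebraicClasses X m') → ∀ ⦃X : Literature.AlgebraicGeometry.Motives.SchemeOver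 ℂ⦄ (f : X ⟶ Literature.AlgebraicGeometry.Motives.projectiveSpace 2 ℂ), Literature.AlgebraicGeometry.Motives.IsSmoothProjective (2 * m) X → Function.Surjective f.left.base → Submodule.span ℂ {c : Literature.AlgebraicGeometry.HodgeTheory.complexBetti X (2 * m) | Literature.AlgebraicGeometry.HodgeTheory.IsRationalClass c ∧ Literature.AlgebraicGeometry.HodgeTheory.IsOfHodgeType (2 * m) X (2 * m) m m c ∧ ∃ T : Set (Literature.AlgebraicGeometry.Motives.projectiveSpace 2 ℂ).left, IsClosed T ∧ T ≠ Set.univ ∧ Literature.AlgebraicGeometry.HodgeTheory.complexBetti.restrictCompl X (f.left.base ⁻¹' T) (2 * m) c = 0} ≤ Literature.AlgebraicGeometry.HodgeTheory.algebraicClasses X m := by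
  sorry

/-- **Assembly, implication form** (kernel-checked, no `sorry`): the three stubs imply the crux
`NoetherLefschetzOneUp.SummitGrantedFourfolds` — strong induction on the level `m`; floor `m = 0`
(`algebraicClasses_zero`), `m = 1` (`LefschetzOneOne_holds`), `m = 2` (the crux's hypothesis);
`m ≥ 3`: a net of `(2m-2)`-folds over `ℙ²` on the `2m`-fold (`exists_fiberNet_smoothBase_nonempty_holds`),
the net stub of the level and the vertical stub on its total space, birational descent along the
blow-down (`isBirational_blowDown`, `mem_algebraicClasses_of_isBirational`); then
`Theorems.middleReduction_proof` (BFNP Lemma 48) and `HodgeModels_holds`. This theorem is also the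
glue of the route split of the crux into `SixfoldNetClasses`, `HigherNetClasses`,
`HigherVerticalClasses`. -/
theorem SummitGrantedFourfolds_of :
    ((∀ ⦃X : Literature.AlgebraicGeometry.Motives.SchemeOver ℂ⦄, Literature.AlgebraicGeometry.Motives.IsSmoothProjective 4 X → ∀ c : Literature.AlgebraicGeometry.HodgeTheory.complexBetti X (2 * 2), Literature.AlgebraicGeometry.HodgeTheory.IsRationalClass c → Literature.AlgebraicGeometry.HodgeTheory.IsOfHodgeType 4 X (2 * 2) 2 2 c → c ∈ Literature.AlgebraicGeometry.HodgeTheory.algebraicClasses X 2) → ∀ ⦃X : Literature.AlgebraicGeometry.Motives.SchemeOver ℂ⦄ (f : X ⟶ Literature.AlgebraicGeometry.Motives.projectiveSpace 2 ℂ), Literature.AlgebraicGeometry.Motives.IsSmoothProjective 6 X → Function.Surjective f.left.base → Submodule.span ℂ {c : Literature.AlgebraicGeometry.HodgeTheory.complexBetti X (2 * 3) | Literature.AlgebraicGeometry.HodgeTheory.IsRationalClass c ∧ Literature.AlgebraicGeometry.HodgeTheory.IsOfHodgeType 6 X (2 * 3) 3 3 c} ≤ Literature.AlgebraicGeometry.HodgeTheory.algebraicClasses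 X 3 ⊔ Submodule.span ℂ {c : Literature.AlgebraicGeometry.HodgeTheory.complexBetti X (2 * 3) | Literature.AlgebraicGeometry.HodgeTheory.IsRationalClass c ∧ Literature.AlgebraicGeometry.HodgeTheory.IsOfHodgeType 6 X (2 * 3) 3 3 c ∧ ∃ T : Set (Literature.AlgebraicGeometry.Motives.projectiveSpace 2 ℂ).left, IsClosed T ∧ T ≠ Set.univ ∧ Literature.AlgebraicGeometry.HodgeTheory.complexBetti.restrictCompl X (f.left.base ⁻¹' T) (2 * 3) c = 0}) →
    (∀ ⦃m : ℕ⦄, 4 ≤ m → (∀ m' : ℕ, m' < m → ∀ ⦃X : Literature.AlgebraicGeometry.Motives.SchemeOver ℂ⦄, Literature.AlgebraicGeometry.Motives.IsSmoothProjective (2 * m') X → ∀ c : Literature.AlgebraicGeometry.HodgeTheory.complexBetti X (2 * m'), Literature.AlgebraicGeometry.HodgeTheory.IsRationalClass c → Literature.AlgebraicGeometry.HodgeTheory.IsOfHodgeType (2 * m') X (2 * m') m' m' c → c ∈ Literature.AlgebraicGeometry.HodgeTheory.algebraicClasses X m') → ∀ ⦃X : Literature.AlgebraicGeometry.Motives.SchemeOver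 ℂ⦄ (f : X ⟶ Literature.AlgebraicGeometry.Motives.projectiveSpace 2 ℂ), Literature.AlgebraicGeometry.Motives.IsSmoothProjective (2 * m) X → Function.Surjective f.left.base → Submodule.span ℂ {c : Literature.AlgebraicGeometry.HodgeTheory.complexBetti X (2 * m) | Literature.AlgebraicGeometry.HodgeTheory.IsRationalClass c ∧ Literature.AlgebraicGeometry.HodgeTheory.IsOfHodgeType (2 * m) X (2 * m) m m c} ≤ Literature.AlgebraicGeometry.HodgeTheory.algebraicClasses X m ⊔ Submodule.span ℂ {c : Literature.AlgebraicGeometry.HodgeTheory.complexBetti X (2 * m) | Literature.AlgebraicGeometry.HodgeTheory.IsRationalClass c ∧ Literature.AlgebraicGeometry.HodgeTheory.IsOfHodgeType (2 * m) X (2 * m) m m c ∧ ∃ T : Set (Literature.AlgebraicGeometry.Motives.projectiveSpace 2 ℂ).left, IsClosed T ∧ T ≠ Set.univ ∧ Literature.AlgebraicGeometry.HodgeTheory.complexBetti.restrictCompl X (f.left.base ⁻¹' T) (2 * m) c = 0}) →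
    (∀ ⦃m : ℕ⦄, 3 ≤ m → (∀ m' : ℕ, m' < m → ∀ ⦃X : Literature.AlgebraicGeometry.Motives.SchemeOver ℂ⦄, Literature.AlgebraicGeometry.Motives.IsSmoothProjective (2 * m') X → ∀ c : Literature.AlgebraicGeometry.HodgeTheory.complexBetti X (2 * m'), Literature.AlgebraicGeometry.HodgeTheory.IsRationalClass c → Literature.AlgebraicGeometry.HodgeTheory.IsOfHodgeType (2 * m') X (2 * m') m' m' c → c ∈ Literature.AlgebraicGeometry.HodgeTheory.algebraicClasses X m') → ∀ ⦃X : Literature.AlgebraicGeometry.Motives.SchemeOver ℂ⦄ (f : X ⟶ Literature.AlgebraicGeometry.Motives.projectiveSpace 2 ℂ), Literature.AlgebraicGeometry.Motives.IsSmoothProjective (2 * m) X → Function.Surjective f.left.base → Submodule.span ℂ {c : Literature.AlgebraicGeometry.HodgeTheory.complexBetti X (2 * m) | Literature.AlgebraicGeometry.HodgeTheory.IsRationalClass c ∧ Literature.AlgebraicGeometry.HodgeTheory.IsOfHodgeType (2 * m) X (2 * m) m m c ∧ ∃ T : Set (Literature.AlgebraicGeometry.Motives.projectiveSpace 2 ℂ).left,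 IsClosed T ∧ T ≠ Set.univ ∧ Literature.AlgebraicGeometry.HodgeTheory.complexBetti.restrictCompl X (f.left.base ⁻¹' T) (2 * m) c = 0} ≤ Literature.AlgebraicGeometry.HodgeTheory.algebraicClasses X m) →
    Summit.HodgeConjecture.HodgeConjecture.Theses.NoetherLefschetzOneUp.SummitGrantedFourfolds := by
  intro h6 hN hV
  unfold Summit.HodgeConjecture.HodgeConjecture.Theses.NoetherLefschetzOneUp.SummitGrantedFourfolds
  intro h42 n X hX
  -- every middle degree, by strong induction on the level `m`
  have hmid : ∀ m : ℕ, ∀ ⦃Y : SchemeOver ℂ⦄, IsSmoothProjective (2 * m) Y →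
      ∀ c : complexBetti Y (2 * m), IsRationalClass c →
        IsOfHodgeType (2 * m) Y (2 * m) m m c → c ∈ algebraicClasses Y m := by
    intro m
    induction m using Nat.strong_induction_on with
    | _ m ih =>
      obtain hm | hm := Nat.lt_or_ge m 3
      · interval_cases m
        · -- level 0: `N⁰ H⁰ = H⁰`
          intro Y _ c _ _
          rw [algebraicClasses_zero]
          exact Submodule.mem_top
        · -- level 1: Lefschetz (1,1) on surfaces (proved support item)
          exact fun Y hY c hc hpp ↦ LefschetzOneOne_holds hY c hc hpp
        · -- level 2: the crux's hypothesis HC(4;2,2)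
          exact fun Y hY c hc hpp ↦ h42 hY c hc hpp
      · -- level m ≥ 3: enter through a net of (2m-2)-folds over ℙ² (tree theorem), split the class
        -- on the total space into net part + vertical part, descend along the blow-down (tree theorem)
        intro Y hY c hc hpp
        obtain ⟨k, rfl⟩ : ∃ k, m = k + 1 := ⟨m - 1, by omega⟩
        have e : 2 + 2 * k = 2 * (k + 1) := by ring
        have hY' : IsSmoothProjective (2 + 2 * k) Y := e ▸ hY
        obtain ⟨N, -⟩ := exists_fiberNet_smoothBase_nonempty_holds (2 * k) 2 (by omega) hY'
        have htot : IsSmoothProjective (2 * (k + 1)) N.total := e ▸ N.isSmoothProjective_total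
        refine mem_algebraicClasses_of_isBirational htot hY N.blowDown (Summit.HodgeConjecture.HodgeConjecture.Theorems.isBirational_blowDown hY' N)
          ?_ c hc hpp
        intro c' hc' hpp'
        have hv := hV hm ih N.proj htot (FiberNet.surjective_proj N)
        obtain hk | hk := Nat.lt_or_ge (k + 1) 4
        · -- level 3: the sixfold net piece, fed with HC(4;2,2)
          obtain rfl : k = 2 := by omega
          have h1 := h6 h42 N.proj htot (FiberNet.surjective_proj N)
          exact (sup_le le_rfl hv) (h1 (Submodule.subset_span ⟨hc', hpp'⟩))
        · -- level ≥ 4: the higher net piece, fed with all lower levels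
          have h1 := hN hk ih N.proj htot (FiberNet.surjective_proj N)
          exact (sup_le le_rfl hv) (h1 (Submodule.subset_span ⟨hc', hpp'⟩))
  -- conjunct 1: Hodge models (proved support item); conjunct 2: BFNP reduction (proved support item)
  exact ⟨HodgeModels_holds hX,
    Summit.HodgeConjecture.HodgeConjecture.Theorems.middleReduction_proof (fun m Y hY c hc hpp ↦ hmid m hY c hc hpp) hX⟩


/-- **The crux from its registered stubs, by name** (no `sorry` of its own; its closure is
conditional on the three `stub_*` placeholders until they are proved). -/
theorem SummitGrantedFourfolds_of_stubs :
    Summit.HodgeConjecture.HodgeConjecture.Theses.NoetherLefschetzOneUp.SummitGrantedFourfolds :=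
  SummitGrantedFourfolds_of stub_sixfoldNetClasses stub_higherNetClasses stub_higherVerticalClasses

/-! ### Bridge to the registered line `birth`

The two stubs of `Lines/birth.lean` (the lead's line: rung `3 | 2` and rungs `≥ 4 | below`) follow from
this line's stubs by the `m = 3` / `m ≥ 4` branches of `SummitGrantedFourfolds_of` — nets of
`(2m-2)`-folds, the net stub of the level, the vertical stub, birational descent. Their statements are
restated VERBATIM from `Lines/birth.lean` (workfiles are not imported from one another), so a proof of
this line's stubs closes the lead's stubs by these two theorems. -/

/-- `birth.stub_sixfoldsGrantedFourfolds` (HC(4;2,2) → every rational `(3,3)`-class on every smooth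
projective sixfold is algebraic) from `stub_sixfoldNetClasses` and `stub_higherVerticalClasses` at
`m = 3`. -/
theorem birth_stub_sixfoldsGrantedFourfolds_of_pieces
    (h6 : (∀ ⦃X : Literature.AlgebraicGeometry.Motives.SchemeOver ℂ⦄, Literature.AlgebraicGeometry.Motives.IsSmoothProjective 4 X → ∀ c : Literature.AlgebraicGeometry.HodgeTheory.complexBetti X (2 * 2), Literature.AlgebraicGeometry.HodgeTheory.IsRationalClass c → Literature.AlgebraicGeometry.HodgeTheory.IsOfHodgeType 4 X (2 * 2) 2 2 c → c ∈ Literature.AlgebraicGeometry.HodgeTheory.algebraicClasses X 2) → ∀ ⦃X : Literature.AlgebraicGeometry.Motives.SchemeOver ℂ⦄ (f : X ⟶ Literature.AlgebraicGeometry.Motives.projectiveSpace 2 ℂ), Literature.AlgebraicGeometry.Motives.IsSmoothProjective 6 X → Function.Surjective f.left.base → Submodule.span ℂ {c : Literature.AlgebraicGeometry.HodgeTheory.complexBetti X (2 * 3) | Literature.AlgebraicGeometry.HodgeTheory.IsRationalClass c ∧ Literature.AlgebraicGeometry.HodgeTheory.IsOfHodgeType 6 X (2 * 3) 3 3 c}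 ≤ Literature.AlgebraicGeometry.HodgeTheory.algebraicClasses X 3 ⊔ Submodule.span ℂ {c : Literature.AlgebraicGeometry.HodgeTheory.complexBetti X (2 * 3) | Literature.AlgebraicGeometry.HodgeTheory.IsRationalClass c ∧ Literature.AlgebraicGeometry.HodgeTheory.IsOfHodgeType 6 X (2 * 3) 3 3 c ∧ ∃ T : Set (Literature.AlgebraicGeometry.Motives.projectiveSpace 2 ℂ).left, IsClosed T ∧ T ≠ Set.univ ∧ Literature.AlgebraicGeometry.HodgeTheory.complexBetti.restrictCompl X (f.left.base ⁻¹' T) (2 * 3) c = 0})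
    (hV : ∀ ⦃m : ℕ⦄, 3 ≤ m → (∀ m' : ℕ, m' < m → ∀ ⦃X : Literature.AlgebraicGeometry.Motives.SchemeOver ℂ⦄, Literature.AlgebraicGeometry.Motives.IsSmoothProjective (2 * m') X → ∀ c : Literature.AlgebraicGeometry.HodgeTheory.complexBetti X (2 * m'), Literature.AlgebraicGeometry.HodgeTheory.IsRationalClass c → Literature.AlgebraicGeometry.HodgeTheory.IsOfHodgeType (2 * m') X (2 * m') m' m' c → c ∈ Literature.AlgebraicGeometry.HodgeTheory.algebraicClasses X m') → ∀ ⦃X : Literature.AlgebraicGeometry.Motives.SchemeOver ℂ⦄ (f : X ⟶ Literature.AlgebraicGeometry.Motives.projectiveSpace 2 ℂ), Literature.AlgebraicGeometry.Motives.IsSmoothProjective (2 * m) X → Function.Surjective f.left.base → Submodule.span ℂ {c : Literature.AlgebraicGeometry.HodgeTheory.complexBetti X (2 * m) | Literature.AlgebraicGeometry.HodgeTheory.IsRationalClass c ∧ Literature.AlgebraicGeometry.HodgeTheory.IsOfHodgeType (2 * m) X (2 * m) m m c ∧ ∃ T : Set (Literature.AlgebraicGeometry.Motives.projectiveSpace 2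 ℂ).left, IsClosed T ∧ T ≠ Set.univ ∧ Literature.AlgebraicGeometry.HodgeTheory.complexBetti.restrictCompl X (f.left.base ⁻¹' T) (2 * m) c = 0} ≤ Literature.AlgebraicGeometry.HodgeTheory.algebraicClasses X m) :
    (∀ ⦃X : SchemeOver ℂ⦄, IsSmoothProjective 4 X → ∀ c : complexBetti X (2 * 2),
      IsRationalClass c → IsOfHodgeType 4 X (2 * 2) 2 2 c → c ∈ algebraicClasses X 2) →
    ∀ ⦃X : SchemeOver ℂ⦄, IsSmoothProjective 6 X → ∀ c : complexBetti X (2 * 3),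
      IsRationalClass c → IsOfHodgeType 6 X (2 * 3) 3 3 c → c ∈ algebraicClasses X 3 := by
  intro h42 Y hY c hc hpp
  -- the lower levels 0, 1, 2 (theorems + the hypothesis)
  have ih : ∀ m' : ℕ, m' < 3 → ∀ ⦃X : SchemeOver ℂ⦄, IsSmoothProjective (2 * m') X →
      ∀ c : complexBetti X (2 * m'), IsRationalClass c →
        IsOfHodgeType (2 * m') X (2 * m') m' m' c → c ∈ algebraicClasses X m' := by
    intro m' hm'
    interval_cases m'
    · intro X _ c _ _
      rw [algebraicClasses_zero]
      exact Submodule.mem_top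
    · exact fun X hX c hc hpp ↦ LefschetzOneOne_holds hX c hc hpp
    · exact fun X hX c hc hpp ↦ h42 hX c hc hpp
  -- a net of fourfolds over ℙ² on the sixfold, the two pieces on its total space, birational descent
  have hY' : IsSmoothProjective (2 + 2 * 2) Y := hY
  obtain ⟨N, -⟩ := exists_fiberNet_smoothBase_nonempty_holds (2 * 2) 2 (by omega) hY'
  have htot : IsSmoothProjective (2 * 3) N.total := N.isSmoothProjective_total
  refine mem_algebraicClasses_of_isBirational htot hY N.blowDown
    (Summit.HodgeConjecture.HodgeConjecture.Theorems.isBirational_blowDown hY' N) ?_ c hc hpp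
  intro c' hc' hpp'
  have hv := hV (show 3 ≤ 3 from le_rfl) ih N.proj htot (FiberNet.surjective_proj N)
  have h1 := h6 h42 N.proj htot (FiberNet.surjective_proj N)
  exact (sup_le le_rfl hv) (h1 (Submodule.subset_span ⟨hc', hpp'⟩))

/-- `birth.stub_ladderFromEightfolds` (for `m ≥ 4`, the middle degree of all smooth projective
`2m`-folds granted all lower levels) from `stub_higherNetClasses` and `stub_higherVerticalClasses`. -/
theorem birth_stub_ladderFromEightfolds_of_pieces
    (hN : ∀ ⦃m : ℕ⦄, 4 ≤ m → (∀ m' : ℕ, m' < m → ∀ ⦃X : Literature.AlgebraicGeometry.Motives.SchemeOver ℂ⦄, Literature.AlgebraicGeometry.Motives.IsSmoothProjective (2 * m') X → ∀ c : Literature.AlgebraicGeometry.HodgeTheory.complexBetti X (2 * m'), Literature.AlgebraicGeometry.HodgeTheory.IsRationalClass c → Literature.AlgebraicGeometry.HodgeTheory.IsOfHodgeType (2 * m') X (2 * m') m' m' c → c ∈ Literature.AlgebraicGeometry.HodgeTheory.algebraicClasses X m') → ∀ ⦃X : Literature.AlgebraicGeometry.Motives.SchemeOver ℂ⦄ (f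 : X ⟶ Literature.AlgebraicGeometry.Motives.projectiveSpace 2 ℂ), Literature.AlgebraicGeometry.Motives.IsSmoothProjective (2 * m) X → Function.Surjective f.left.base → Submodule.span ℂ {c : Literature.AlgebraicGeometry.HodgeTheory.complexBetti X (2 * m) | Literature.AlgebraicGeometry.HodgeTheory.IsRationalClass c ∧ Literature.AlgebraicGeometry.HodgeTheory.IsOfHodgeType (2 * m) X (2 * m) m m c} ≤ Literature.AlgebraicGeometry.HodgeTheory.algebraicClasses X m ⊔ Submodule.span ℂ {c : Literature.AlgebraicGeometry.HodgeTheory.complexBetti X (2 * m) | Literature.AlgebraicGeometry.HodgeTheory.IsRationalClass c ∧ Literature.AlgebraicGeometry.HodgeTheory.IsOfHodgeType (2 * m) X (2 * m) m m c ∧ ∃ T : Set (Literature.AlgebraicGeometry.Motives.projectiveSpace 2 ℂ).left, IsClosed T ∧ T ≠ Set.univ ∧ Literature.AlgebraicGeometry.HodgeTheory.complexBetti.restrictCompl X (f.left.base ⁻¹' T) (2 * m) c = 0})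
    (hV : ∀ ⦃m : ℕ⦄, 3 ≤ m → (∀ m' : ℕ, m' < m → ∀ ⦃X : Literature.AlgebraicGeometry.Motives.SchemeOver ℂ⦄, Literature.AlgebraicGeometry.Motives.IsSmoothProjective (2 * m') X → ∀ c : Literature.AlgebraicGeometry.HodgeTheory.complexBetti X (2 * m'), Literature.AlgebraicGeometry.HodgeTheory.IsRationalClass c → Literature.AlgebraicGeometry.HodgeTheory.IsOfHodgeType (2 * m') X (2 * m') m' m' c → c ∈ Literature.AlgebraicGeometry.HodgeTheory.algebraicClasses X m') → ∀ ⦃X : Literature.AlgebraicGeometry.Motives.SchemeOver ℂ⦄ (f : X ⟶ Literature.AlgebraicGeometry.Motives.projectiveSpace 2 ℂ), Literature.AlgebraicGeometry.Motives.IsSmoothProjective (2 * m) X → Function.Surjective f.left.base → Submodule.span ℂ {c : Literature.AlgebraicGeometry.HodgeTheory.complexBetti X (2 * m) | Literature.AlgebraicGeometry.HodgeTheory.IsRationalClass c ∧ Literature.AlgebraicGeometry.HodgeTheory.IsOfHodgeType (2 * m) X (2 * m) m m c ∧ ∃ T : Set (Literature.AlgebraicGeometry.Motives.projectiveSpace 2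 ℂ).left, IsClosed T ∧ T ≠ Set.univ ∧ Literature.AlgebraicGeometry.HodgeTheory.complexBetti.restrictCompl X (f.left.base ⁻¹' T) (2 * m) c = 0} ≤ Literature.AlgebraicGeometry.HodgeTheory.algebraicClasses X m) :
    ∀ m : ℕ, 4 ≤ m →
      (∀ m' : ℕ, m' < m → ∀ ⦃X : SchemeOver ℂ⦄, IsSmoothProjective (2 * m') X →
        ∀ c : complexBetti X (2 * m'), IsRationalClass c →
          IsOfHodgeType (2 * m') X (2 * m') m' m' c → c ∈ algebraicClasses X m') →
      ∀ ⦃X : SchemeOver ℂ⦄, IsSmoothProjective (2 * m) X → ∀ c : complexBetti X (2 * m),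
        IsRationalClass c → IsOfHodgeType (2 * m) X (2 * m) m m c → c ∈ algebraicClasses X m := by
  intro m hm ih Y hY c hc hpp
  obtain ⟨k, rfl⟩ : ∃ k, m = k + 1 := ⟨m - 1, by omega⟩
  have e : 2 + 2 * k = 2 * (k + 1) := by ring
  have hY' : IsSmoothProjective (2 + 2 * k) Y := e ▸ hY
  obtain ⟨N, -⟩ := exists_fiberNet_smoothBase_nonempty_holds (2 * k) 2 (by omega) hY'
  have htot : IsSmoothProjective (2 * (k + 1)) N.total := e ▸ N.isSmoothProjective_total
  refine mem_algebraicClasses_of_isBirational htot hY N.blowDown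
    (Summit.HodgeConjecture.HodgeConjecture.Theorems.isBirational_blowDown hY' N) ?_ c hc hpp
  intro c' hc' hpp'
  have hv := hV (show 3 ≤ k + 1 by omega) ih N.proj htot (FiberNet.surjective_proj N)
  have h1 := hN hm ih N.proj htot (FiberNet.surjective_proj N)
  exact (sup_le le_rfl hv) (h1 (Submodule.subset_span ⟨hc', hpp'⟩))

end Summit.HodgeConjecture.HodgeConjecture.Cruxes.SummitGrantedFourfolds.NetRegimeSplit

end
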